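import Summits.BirchSwinnertonDyer.BirchSwinnertonDyer.Theorems.QuadraticBranchSignedControlPlusEtaNonsurjCartanField
import Literature.NumberTheory.EllipticCurves.OpenImageMazurTwistProofs
import Literature.NumberTheory.EllipticCurves.VariableChangePointsMap
import HarnessLib

/-!
# Route `QuadraticBranchSignedControl` (rung K8, cell `bsd-potss`): crux stmt-BirchSwinnertonDyer-19606
# `PlusEtaMainConjectureNonsurj` — THE PARTNER HAS THE SAME CARTAN FIELD: `H_W = H_V` for `C • W^{(p*)} = V`

WHAT. The cell records mod-`p` congruences of the Gss2 pairs on BOTH sides — curve side (`V ≡ A`) and twist side (the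
additive partners, `W ≡ A'`, k8eta-c2 g8's `EtaModFiveCongruenceRecords` B–F) — and the Cartan subgroup
`H_V = ρ̄⁻¹(C_ns(p))` (frame-free: "`σ` centralises the squares on `V[p]`", `…PlusEtaNonsurjCartanField`) is the
invariant deciding which anchors are possible (`…CartanFieldCMAnchor`). This file shows the invariant is the SAME on both
members of a pair: along the untwisting `W(ℚ̄) ≃+ W^{(d)}(ℚ̄)` (Silverman X.5 Cor. 5.4), `Γ_ℚ`-equivariant up to the sign
`χ_d(σ) = ±1`, the SQUARES act equivariantly (the signs cancel), so "centralises the squares" transports verbatim — no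
frame and no image hypothesis needed:

* `centralizes_sq_iff_of_addEquiv_signed` — for an additive `g : W'(ℚ̄) ≃+ W(ℚ̄)` with `g(σP) = ±σ g(P)` (sign depending
  on `σ` only): `σ` centralises the squares on `W'[p]` iff it does on `W[p]`;
* `centralizes_sq_iff_of_smul_eq` (change of variables), `centralizes_sq_quadraticTwist_iff` (quadratic twist);
* **`centralizes_sq_partner_iff`** — for `C • W^{(p*)} = V` (`p` odd): `σ` centralises the squares on `W[p]` ⟺ on `V[p]`,
  i.e. **`H_W = H_V`, `K_W = K_V`**: a CM anchor of the PARTNER pins the same field (combine with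
  `centralizes_sq_iff_chi_eq_one_of_modPCongruent`), and the twist-side certificates of the cell decide the same question
  as the curve-side ones.

HONEST FRAMING (cell `bsd-potss`, run/shared/lean/pub/bsd-potss/; FULL-BSD rank ≤ 1 programme): TOOL THEOREMS ONLY (no
definition, no named fact, no `sorry`, axioms standard). Nothing is booked; crux 19606 stays OPEN; `BSD(W, p)` is
claimed for no pair. Seat `bsd-potss-k8eta-c2` g9 (prover), `--supports stmt-BirchSwinnertonDyer-19606`.

References: [SilvermanAEC2009] X.5 Cor. 5.4, X.2 Prop. 2.4; [Serre1972] §2.2.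
-/

set_option autoImplicit false
set_option linter.dupNamespace false

noncomputable section

open scoped Classical

open Field WeierstrassCurve Literature.NumberTheory.EllipticCurves Literature.NumberTheory.SerreUniformity

namespace Summit.BirchSwinnertonDyer.BirchSwinnertonDyer.Theorems.EtaCartanField

variable {p : ℕ}

/-- **"Centralises the squares" transports along a signed-equivariant isomorphism.** Let `g : W'(ℚ̄) ≃+ W(ℚ̄)` be
additive with, for every `σ ∈ Γ_ℚ`, either `g(σP) = σ g(P)` for all `P` or `g(σP) = −σ g(P)` for all `P`. Then `g`
commutes with the action of every SQUARE `τ²` (the two signs cancel), and `σ` centralises the squares on `W'[p]` iff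
it does on `W[p]`. [cite: SilvermanAEC2009, X.5 Cor. 5.4] -/
theorem centralizes_sq_iff_of_addEquiv_signed {W W' : WeierstrassCurve ℚ} (g : W'.geomPoints ≃+ W.geomPoints)
    (hg : ∀ σ : absoluteGaloisGroup ℚ,
      (∀ P, g (σ • P) = σ • g P) ∨ (∀ P, g (σ • P) = -(σ • g P)))
    (σ : absoluteGaloisGroup ℚ) :
    (∀ (τ : absoluteGaloisGroup ℚ) (P : W'.geomTorsion p), σ • ((τ * τ) • P) = (τ * τ) • (σ • P)) ↔
      ∀ (τ : absoluteGaloisGroup ℚ) (Q : W.geomTorsion p), σ • ((τ * τ) • Q) = (τ * τ) • (σ • Q) := by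
  -- squares act equivariantly through `g`
  have hsq : ∀ (τ : absoluteGaloisGroup ℚ) (X : W'.geomPoints), g ((τ * τ) • X) = (τ * τ) • g X := by
    intro τ X
    rw [mul_smul, mul_smul]
    rcases hg τ with h | h
    · rw [h, h]
    · rw [h, h, smul_neg, neg_neg]
  -- `σ` acts through `g` up to a sign `s ∈ {id, neg}` compatible with the action
  have hσ : ∃ s : W.geomPoints → W.geomPoints, (∀ X, g (σ • X) = s (σ • g X)) ∧ Function.Injective s ∧
      (∀ (ν : absoluteGaloisGroup ℚ) (Y : W.geomPoints), ν • s Y = s (ν • Y)) := by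
    rcases hg σ with h | h
    · exact ⟨id, h, Function.injective_id, fun ν Y => rfl⟩
    · exact ⟨fun Y => -Y, h, neg_injective, fun ν Y => smul_neg ν Y⟩
  obtain ⟨s, hs, hsinj, hscomm⟩ := hσ
  -- torsion bookkeeping: `g` preserves `p`-torsion
  have htor : ∀ {X : W'.geomPoints}, X ∈ W'.geomTorsion p ↔ g X ∈ W.geomTorsion p := by
    intro X
    rw [geomTorsion, geomTorsion, AddSubgroup.torsionBy.nsmul_iff, AddSubgroup.torsionBy.nsmul_iff, ← map_nsmul,
      AddEquiv.map_eq_zero_iff]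
  constructor
  · intro h τ Q
    -- pull `Q` back to `W'[p]`
    have hQ' : g.symm (Q : W.geomPoints) ∈ W'.geomTorsion p := by rw [htor, g.apply_symm_apply]; exact Q.2
    have h1 := congrArg (fun X : W'.geomTorsion p => g (X : W'.geomPoints)) (h τ ⟨g.symm Q, hQ'⟩)
    simp only [AddSubgroup.torsionBy.coe_smul] at h1
    rw [hs, hsq, g.apply_symm_apply, hsq, hs, g.apply_symm_apply, hscomm] at h1
    exact Subtype.ext (by simpa only [AddSubgroup.torsionBy.coe_smul] using hsinj h1)
  · intro h τ P
    apply Subtype.ext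
    apply g.injective
    simp only [AddSubgroup.torsionBy.coe_smul]
    rw [hs, hsq, hsq, hs, hscomm]
    have h1 := congrArg (fun X : W.geomTorsion p => (X : W.geomPoints)) (h τ ⟨g P, htor.mp P.2⟩)
    simp only [AddSubgroup.torsionBy.coe_smul] at h1
    rw [h1]

/-- **Change of variables**: `σ` centralises the squares on `X[p]` iff on `(C • X)[p]`. [folklore] -/
theorem centralizes_sq_iff_of_smul_eq {X Y : WeierstrassCurve ℚ} (C : VariableChange ℚ) (hXY : C • X = Y)
    (σ : absoluteGaloisGroup ℚ) :
    (∀ (τ : absoluteGaloisGroup ℚ) (P : X.geomTorsion p), σ • ((τ * τ) • P) = (τ * τ) • (σ • P)) ↔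
      ∀ (τ : absoluteGaloisGroup ℚ) (Q : Y.geomTorsion p), σ • ((τ * τ) • Q) = (τ * τ) • (σ • Q) := by
  subst hXY
  let e : X.geomPoints ≃+ (C • X).geomPoints := VariableChange.pointEquivBaseChange X C (AlgebraicClosure ℚ)
  have he : ∀ (τ : absoluteGaloisGroup ℚ) (P : X.geomPoints), e (τ • P) = τ • e P := fun τ P ↦
    VariableChange.pointEquivBaseChange_map_algEquiv X C (absoluteGaloisGroup.toAlgEquiv ℚ τ) P
  exact centralizes_sq_iff_of_addEquiv_signed e (fun ν => Or.inl (he ν)) σ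

/-- **Quadratic twist**: `σ` centralises the squares on `W^{(d)}[p]` iff on `W[p]` (`d ≠ 0`).
[cite: SilvermanAEC2009, X.5 Cor. 5.4] -/
theorem centralizes_sq_quadraticTwist_iff (W : WeierstrassCurve ℚ) {d : ℚ} (hd : d ≠ 0)
    (σ : absoluteGaloisGroup ℚ) :
    (∀ (τ : absoluteGaloisGroup ℚ) (P : (W.quadraticTwist d).geomTorsion p),
        σ • ((τ * τ) • P) = (τ * τ) • (σ • P)) ↔
      ∀ (τ : absoluteGaloisGroup ℚ) (Q : W.geomTorsion p), σ • ((τ * τ) • Q) = (τ * τ) • (σ • Q) := by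
  obtain ⟨f, hf⟩ := exists_addEquiv_geomPoints_quadraticTwist_signed W hd
  exact centralizes_sq_iff_of_addEquiv_signed f hf σ

/-- **The partner has the same Cartan field.** For `C • W^{(p*)} = V` (`p` prime): `σ` centralises the squares on `W[p]`
iff on `V[p]` — **`H_W = H_V`** (so `K_W = K_V`; a CM anchor of the partner pins the same field, and the twist-side
congruence certificates of the cell decide the same question as the curve-side ones). [cite: SilvermanAEC2009, X.5 Cor. 5.4]
[cite: Serre1972, §2.2] -/
theorem centralizes_sq_partner_iff [Fact p.Prime] {V W : WeierstrassCurve ℚ} (C : VariableChange ℚ)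
    (hCV : C • W.quadraticTwist ((-1) ^ (p / 2) * p) = V) (σ : absoluteGaloisGroup ℚ) :
    (∀ (τ : absoluteGaloisGroup ℚ) (P : W.geomTorsion p), σ • ((τ * τ) • P) = (τ * τ) • (σ • P)) ↔
      ∀ (τ : absoluteGaloisGroup ℚ) (Q : V.geomTorsion p), σ • ((τ * τ) • Q) = (τ * τ) • (σ • Q) := by
  have hp : p.Prime := Fact.out
  have hd0 : ((-1 : ℚ) ^ (p / 2) * p) ≠ 0 :=
    mul_ne_zero (pow_ne_zero _ (by norm_num)) (Nat.cast_ne_zero.mpr hp.ne_zero)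
  rw [← centralizes_sq_quadraticTwist_iff W hd0 σ]
  exact centralizes_sq_iff_of_smul_eq C hCV σ

/-- **Row-level form**: on a row of crux 19606 (`V` glob. min., `p ≥ 5` good, `a_p = 0`, tower not onto) with partner
`W` (`C • W^{(p*)} = V`), the index-`2` Cartan subgroup `H_V` of `exists_cartanSubgroup_of_row` is ALSO the set of
`σ` centralising the squares on `W[p]`. [cite: SilvermanAEC2009, X.5 Cor. 5.4] [cite: Serre1972, §2.2] -/
theorem exists_cartanSubgroup_partner_of_row (V : WeierstrassCurve ℚ) [V.IsElliptic] [V.IsGloballyMinimal]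
    (W : WeierstrassCurve ℚ) (C : VariableChange ℚ) (p : ℕ) [Fact p.Prime] (hp5 : 5 ≤ p)
    (hCV : C • W.quadraticTwist ((-1) ^ (p / 2) * p) = V) (hgood : V.HasGoodReductionAtPrime p)
    (hap : V.frobeniusTrace p = 0) (hns : ¬ ∀ m : ℕ, V.HasSurjectiveModNGaloisRep (p ^ m : ℕ)) :
    ∃ H : Subgroup (absoluteGaloisGroup ℚ), H.index = 2 ∧
      (∀ σ : absoluteGaloisGroup ℚ, σ ∈ H ↔
        ∀ (τ : absoluteGaloisGroup ℚ) (P : V.geomTorsion p), σ • ((τ * τ) • P) = (τ * τ) • (σ • P)) ∧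
      (∀ σ : absoluteGaloisGroup ℚ, σ ∈ H ↔
        ∀ (τ : absoluteGaloisGroup ℚ) (P : W.geomTorsion p), σ • ((τ * τ) • P) = (τ * τ) • (σ • P)) := by
  obtain ⟨H, hH2, hH⟩ := exists_cartanSubgroup_of_row V p hp5 hgood hap hns
  exact ⟨H, hH2, hH, fun σ => (hH σ).trans (centralizes_sq_partner_iff C hCV σ).symm⟩

end Summit.BirchSwinnertonDyer.BirchSwinnertonDyer.Theorems.EtaCartanField

end
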